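import Summits.QuantumFields.YangMills.Theorems.AlphaInputsT3ACv3EMLSecondOrderMain
import Summits.QuantumFields.YangMills.Theorems.AlphaInputsT3ACv3PerturbedPlaquette
import Summits.QuantumFields.YangMills.Theorems.UnitScaleTiltProp7HolRatioPerStep
import Literature.MathematicalPhysics.QuantumFieldTheory.Balaban1983to89.BlockAveragingEMLLinearisedBackground
import Literature.MathematicalPhysics.QuantumFieldTheory.Balaban1983to89.B10StarCount
import HarnessLib

/-!
# `AlphaInputsT3ACv3CovLinAvgFrame` — STRATEGY B for 2′, the (FL) row under OWNER RULING g24-№4 («Newton∕IFT on the (LL) engine»): **THE ONE-STEP FRAME LETTER** —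
# the covariant linearised (0.4) average at an ARBITRARY background `U₀` is the FLAT linearised average of the frame-rotated perturbation, conjugated back to the base point,
# up to an error linear in the flatness defect of the background IN THE FRAME — lane `pub-balaban3d` ∕ cell `ym3-torus`, seat `ym-ust-19936-w4` (g0)

WHY (cell `ym3-torus` STATUS 2026-08-28, this seat's PROGRESS 1 (F); memo `NEWTON-FL-FRAMES-w4-g0.md` §2, 19936 evidence #58).  The tree linearises ONE step of the (0.4)∕`exp[mean log]`
averaging at a general background: `‖Ū(c)·Ū₀(c)* − 1 − (Q₁(U₀)Y)(c)‖ ≤ 400ℓδ(ℓδ+α)` (`BlockAveragingEMLLinearisedBackground.norm_avgFun_ratio_sub_one_sub_covLinAvg_le`; `Y = UU₀⁻¹ − 1`,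
`Q₁(U₀) = covLinAvg U₀` transports each `Y_b` back to the block centre along the averaging walk, α = deviation of the background's (0.4) LOOP variables from 1 — no smallness of its BOND
variables).  The (LL) engine (`LinearLiftSpread.liftS`, `linAvgIter_liftS = id`) inverts the FLAT average `BlockAveragingEMLLinearised.linAvg` componentwise.  Between the two sits the
frame: a gauge `u` in which the background is η-close to `1` on the two blocks of `c` (e.g. the regional comb-axial gauge of `…v3RegionAxialGauge`, η = O(L·plaquette size)).  THIS FILE:
* §1 GAUGE COVARIANCE of the covariant calculus (the `SU(n)` coercion letters are the tree's `Prop7HolRatioPerStep.coe_star_mul_self`∕`coe_mul_star_self`): `coe_gaugeAct`, `pertVar_gaugeAct` (`Y ↦ u(b₋)Y_b u(b₋)*`), ★ `covWalkSum_gaugeAct_walk` (`Y_{U₀^u}^{u}(Γ) = u(x)·Y_{U₀}(Γ)·u(x)*` for a walk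
  from `x`), ★ `covLinAvg_gaugeAct` (`Q₁(U₀^u)(Y^u)(c) = u(y₀)·Q₁(U₀)Y(c)·u(y₀)*`, `y₀ = emb c₋`).
* §2 NEAR-FLAT COMPARISON: `norm_covWalkSum_sub_walkSum_le` (`‖Y_{U₀}(Γ) − Y(Γ)‖ ≤ ηδ·|Γ|(|Γ|+1)` when the background is η-flat on Γ), ★ `norm_covLinAvg_sub_linAvg_le` (`‖Q₁(U₀)Y(c) − (Q₁Y)(c)‖ ≤ 2ηδ·ℓ(ℓ+1)`, ℓ = (d+2)L, η-flatness asked on the two blocks of `c` only).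
* §3 ★★ THE FRAME LETTER `norm_covLinAvg_sub_conj_linAvg_le`: for ANY gauge `u` with `U₀^u` η-flat on the two blocks of `c`,
  `‖Q₁(U₀)Y(c) − u(y₀)*·(Q₁ Y^u)(c)·u(y₀)‖ ≤ 2ηδ·ℓ(ℓ+1)`, and ★★ `norm_avgFun_ratio_sub_one_sub_conj_linAvg_le`: the one-step expansion of the tree with the FLAT average of the rotated
  perturbation as its linear term (remainder `400ℓδ(ℓδ+α) + 2ηδℓ(ℓ+1)`) — the `T = rotate⁻¹ ∘ linAvg ∘ rotate + O(η)` input of the Newton shell `…v3NewtonShell` (κ-side), one level.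
Count-neutral helper toward R3 2′ (items 19936∕19935); (FL)∕`hLift` NOT proved here; registry untouched; nothing about d = 4, the continuum, or a mass gap; YM₃ on T³ is rung R3, not Clay.

References: T. Bałaban, Commun. Math. Phys. 98 (1985) 17–51 [Balaban1985Averaging] ((8), (11)–(13) pp.18–19, (56)–(58) p.27, Prop. 3 (122)–(125) p.36); CMP 109 (1987) 249–301
[Balaban1987RG1] ((0.3)–(0.4) pp.252–253).
-/

set_option autoImplicit false

noncomputable section

open scoped Matrix.Norms.L2Operator BigOperators

namespace Summit.QuantumFields.YangMills.Theorems.CovLinAvgFrame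

open Literature.MathematicalPhysics.QuantumFieldTheory.Balaban1983to89
open T4Continuum BlockAveraging BlockAveragingEMLLinearised BlockAveragingEMLLinearisedBackground AveragingRT LatticeWordStokes ExpMeanLog
open Summit.QuantumFields.YangMills.Theorems.PerturbedPlaquette (dist1_SU_eq norm_conj_SU coe_mul_exp_eq)
open Summit.QuantumFields.YangMills.Theorems.Prop7CovariantCoercivity (norm_conj_sub_self_le')
open Summit.QuantumFields.YangMills.Theorems.EMLSecondOrder (mean_walkSum_loop_add_axial_eq_linAvg)
open Summit.QuantumFields.YangMills.Theorems.Prop7HolRatioPerStep (coe_star_mul_self coe_mul_star_self)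

variable {n : Type*} [Fintype n] [DecidableEq n] [Nonempty n] {P : Params} {j : ℕ}

/-! ## §1 Gauge covariance of the covariant first-order calculus -/

/-- The matrix of a gauge-transformed bond variable: `(U^u)_b = u(b₋)·U_b·u(b₊)*`. [cite: Balaban1985Averaging, (8) p.18] -/
theorem coe_gaugeAct (u : GaugeTransf P j (Matrix.specialUnitaryGroup n ℂ)) (U : GaugeField P j (Matrix.specialUnitaryGroup n ℂ)) (b : PBond P j) :
    ((GaugeField.gaugeAct u U b : Matrix.specialUnitaryGroup n ℂ) : Matrix n n ℂ) =
      (u b.src : Matrix n n ℂ) * (U b : Matrix n n ℂ) * star (u b.tgt : Matrix n n ℂ) := by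
  show (((u b.src * U b * (u b.tgt)⁻¹ : Matrix.specialUnitaryGroup n ℂ)) : Matrix n n ℂ) = _
  rw [Submonoid.coe_mul, Submonoid.coe_mul]
  rfl

/-- **THE PERTURBATION VARIABLE IS CONJUGATED AT THE INITIAL POINT**: `Y_b(U^u, U₀^u) = u(b₋)·Y_b(U, U₀)·u(b₋)*` (`Y = UU₀⁻¹ − 1` is a left perturbation at `b₋`).
[cite: Balaban1985Variational, (15) p.280] -/
theorem pertVar_gaugeAct (u : GaugeTransf P j (Matrix.specialUnitaryGroup n ℂ)) (U₀ U : GaugeField P j (Matrix.specialUnitaryGroup n ℂ)) (b : PBond P j) :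
    pertVar (GaugeField.gaugeAct u U₀) (GaugeField.gaugeAct u U) b = (u b.src : Matrix n n ℂ) * pertVar U₀ U b * star (u b.src : Matrix n n ℂ) := by
  rw [pertVar_eq, pertVar_eq, coe_gaugeAct, coe_gaugeAct]
  simp only [star_mul, star_star, mul_sub, sub_mul, mul_one]
  congr 1
  · calc (u b.src : Matrix n n ℂ) * (U b : Matrix n n ℂ) * star (u b.tgt : Matrix n n ℂ) *
          ((u b.tgt : Matrix n n ℂ) * (star (U₀ b : Matrix n n ℂ) * star (u b.src : Matrix n n ℂ)))
        = (u b.src : Matrix n n ℂ) * (U b : Matrix n n ℂ) * (star (u b.tgt : Matrix n n ℂ) * (u b.tgt : Matrix n n ℂ)) *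
            star (U₀ b : Matrix n n ℂ) * star (u b.src : Matrix n n ℂ) := by noncomm_ring
      _ = _ := by rw [coe_star_mul_self, mul_one]; noncomm_ring
  · rw [coe_mul_star_self]

omit [Nonempty n] in
/-- `‖u·X·u*‖ ≤ δ` from `‖X‖ ≤ δ`: conjugated perturbations keep their bound. [cite: Balaban1985Averaging, (19) p.21] -/
theorem norm_conj_le_of_le (g : Matrix.specialUnitaryGroup n ℂ) {X : Matrix n n ℂ} {δ : ℝ} (h : ‖X‖ ≤ δ) :
    ‖(g : Matrix n n ℂ) * X * star (g : Matrix n n ℂ)‖ ≤ δ := by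
  rw [norm_conj_SU]; exact h

/-- **★ GAUGE COVARIANCE OF THE COVARIANT SIGNED SUM**: along a lattice walk from `x`, `Y^{u}_{U₀^u}(Γ) = u(x)·Y_{U₀}(Γ)·u(x)*` for the conjugated perturbation `Y^u_b = u(b₋)Y_b u(b₋)*` —
every step term is transported to the start of the walk, where the gauge acts by `u(x)`. [cite: Balaban1985Averaging, (11)–(13) p.19, (58) p.27] -/
theorem covWalkSum_gaugeAct_walk (u : GaugeTransf P j (Matrix.specialUnitaryGroup n ℂ)) (U₀ : GaugeField P j (Matrix.specialUnitaryGroup n ℂ))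
    (Y : PBond P j → Matrix n n ℂ) :
    ∀ (x : Site P j) (w : List (Letter P.d)),
      covWalkSum (GaugeField.gaugeAct u U₀) (fun b => (u b.src : Matrix n n ℂ) * Y b * star (u b.src : Matrix n n ℂ)) (walk x w) =
        (u x : Matrix n n ℂ) * covWalkSum U₀ Y (walk x w) * star (u x : Matrix n n ℂ)
  | x, [] => by simp [walk]
  | x, (μ, true) :: w => by
    rw [walk, covWalkSum_cons, covWalkSum_cons, covWalkSum_gaugeAct_walk u U₀ Y (x.shift μ) w]
    -- the forward step `b = ⟨x, μ⟩`: `b₋ = x`, `b₊ = x + e_μ`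
    have hsf : stepFactor (GaugeField.gaugeAct u U₀) ⟨⟨x, μ⟩, true⟩ = (u x : Matrix n n ℂ) * (U₀ ⟨x, μ⟩ : Matrix n n ℂ) * star (u (x.shift μ) : Matrix n n ℂ) := by
      simp only [stepFactor, ↓reduceIte, coe_gaugeAct]; rfl
    have hsf0 : stepFactor U₀ ⟨⟨x, μ⟩, true⟩ = (U₀ ⟨x, μ⟩ : Matrix n n ℂ) := by simp only [stepFactor, ↓reduceIte]
    have hcs : covStep (GaugeField.gaugeAct u U₀) (fun b => (u b.src : Matrix n n ℂ) * Y b * star (u b.src : Matrix n n ℂ)) ⟨⟨x, μ⟩, true⟩ =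
        (u x : Matrix n n ℂ) * Y ⟨x, μ⟩ * star (u x : Matrix n n ℂ) := by simp only [covStep, ↓reduceIte]
    have hcs0 : covStep U₀ Y ⟨⟨x, μ⟩, true⟩ = Y ⟨x, μ⟩ := by simp only [covStep, ↓reduceIte]
    rw [hsf, hsf0, hcs, hcs0, star_mul, star_mul, star_star]
    set ux := (u x : Matrix n n ℂ)
    set ux' := (u (x.shift μ) : Matrix n n ℂ)
    set V := (U₀ ⟨x, μ⟩ : Matrix n n ℂ)
    set S := covWalkSum U₀ Y (walk (x.shift μ) w)
    calc ux * Y ⟨x, μ⟩ * star ux + ux * V * star ux' * (ux' * S * star ux') * (ux' * (star V * star ux))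
        = ux * Y ⟨x, μ⟩ * star ux + ux * V * (star ux' * ux') * S * (star ux' * ux') * star V * star ux := by noncomm_ring
      _ = ux * (Y ⟨x, μ⟩ + V * S * star V) * star ux := by rw [coe_star_mul_self]; noncomm_ring
  | x, (μ, false) :: w => by
    rw [walk, covWalkSum_cons, covWalkSum_cons, covWalkSum_gaugeAct_walk u U₀ Y (x.unshift μ) w]
    -- the backward step over `b = ⟨x − e_μ, μ⟩`: `b₋ = x − e_μ`, `b₊ = x`
    have hxt : PBond.tgt (⟨x.unshift μ, μ⟩ : PBond P j) = x := B10StarCount.shift_unshift x μ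
    have hsf : stepFactor (GaugeField.gaugeAct u U₀) ⟨⟨x.unshift μ, μ⟩, false⟩ =
        (u x : Matrix n n ℂ) * star (U₀ ⟨x.unshift μ, μ⟩ : Matrix n n ℂ) * star (u (x.unshift μ) : Matrix n n ℂ) := by
      simp only [stepFactor, Bool.false_eq_true, ↓reduceIte, coe_gaugeAct, star_mul, star_star, hxt, mul_assoc]
    have hsf0 : stepFactor U₀ ⟨⟨x.unshift μ, μ⟩, false⟩ = star (U₀ ⟨x.unshift μ, μ⟩ : Matrix n n ℂ) := by
      simp only [stepFactor, Bool.false_eq_true, ↓reduceIte]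
    have hcs : covStep (GaugeField.gaugeAct u U₀) (fun b => (u b.src : Matrix n n ℂ) * Y b * star (u b.src : Matrix n n ℂ)) ⟨⟨x.unshift μ, μ⟩, false⟩ =
        -(stepFactor (GaugeField.gaugeAct u U₀) ⟨⟨x.unshift μ, μ⟩, false⟩ *
          ((u (x.unshift μ) : Matrix n n ℂ) * Y ⟨x.unshift μ, μ⟩ * star (u (x.unshift μ) : Matrix n n ℂ)) *
          star (stepFactor (GaugeField.gaugeAct u U₀) ⟨⟨x.unshift μ, μ⟩, false⟩)) := by
      simp only [covStep, Bool.false_eq_true, ↓reduceIte]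
    have hcs0 : covStep U₀ Y ⟨⟨x.unshift μ, μ⟩, false⟩ =
        -(stepFactor U₀ ⟨⟨x.unshift μ, μ⟩, false⟩ * Y ⟨x.unshift μ, μ⟩ * star (stepFactor U₀ ⟨⟨x.unshift μ, μ⟩, false⟩)) := by
      simp only [covStep, Bool.false_eq_true, ↓reduceIte]
    rw [hcs, hcs0, hsf, hsf0]
    simp only [star_mul, star_star]
    set ux := (u x : Matrix n n ℂ)
    set ux' := (u (x.unshift μ) : Matrix n n ℂ)
    set V := (U₀ ⟨x.unshift μ, μ⟩ : Matrix n n ℂ)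
    set S := covWalkSum U₀ Y (walk (x.unshift μ) w)
    set Yb := Y ⟨x.unshift μ, μ⟩
    calc -(ux * star V * star ux' * (ux' * Yb * star ux') * (ux' * (V * star ux))) +
          ux * star V * star ux' * (ux' * S * star ux') * (ux' * (V * star ux))
        = -(ux * star V * (star ux' * ux') * Yb * (star ux' * ux') * V * star ux) +
            ux * star V * (star ux' * ux') * S * (star ux' * ux') * V * star ux := by noncomm_ring
      _ = ux * (-(star V * Yb * V) + star V * S * V) * star ux := by rw [coe_star_mul_self]; noncomm_ring

/-- **★ GAUGE COVARIANCE OF THE LINEARISED (0.4) AVERAGE AT A BACKGROUND**: `Q₁(U₀^u)(Y^u)(c) = u(y₀)·Q₁(U₀)Y(c)·u(y₀)*`, `y₀ = emb c₋` (all the walks of (0.4) at `c` start at the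
block centre). [cite: Balaban1985Averaging, (11)–(13) p.19, (124) p.36] -/
theorem covLinAvg_gaugeAct (u : GaugeTransf P j (Matrix.specialUnitaryGroup n ℂ)) (U₀ : GaugeField P j (Matrix.specialUnitaryGroup n ℂ))
    (Y : PBond P j → Matrix n n ℂ) (c : PBond P (j + 1)) :
    covLinAvg (GaugeField.gaugeAct u U₀) (fun b => (u b.src : Matrix n n ℂ) * Y b * star (u b.src : Matrix n n ℂ)) c =
      (u (emb c.src) : Matrix n n ℂ) * covLinAvg U₀ Y c * star (u (emb c.src) : Matrix n n ℂ) := by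
  rw [covLinAvg_def, covLinAvg_def]
  simp only [covWalkSum_gaugeAct_walk]
  rw [mul_add, add_mul, ← Finset.sum_mul, ← Finset.mul_sum, Finset.mul_sum, Finset.sum_mul, Finset.smul_sum, Finset.smul_sum, Finset.mul_sum,
    Finset.sum_mul]
  congr 1
  refine Finset.sum_congr rfl fun i _ => ?_
  rw [mul_smul_comm, smul_mul_assoc]

/-! ## §2 Near-flat comparison: covariant sums against flat sums -/

omit [Nonempty n] in
/-- The matrix of a step factor is the coercion of the group step `U_b^{±1}`. [folklore] -/
theorem stepFactor_eq_coe (U₀ : GaugeField P j (Matrix.specialUnitaryGroup n ℂ)) (s : LStep P j) :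
    stepFactor U₀ s = (((if s.fwd then U₀ s.bond else (U₀ s.bond)⁻¹ : Matrix.specialUnitaryGroup n ℂ)) : Matrix n n ℂ) := by
  unfold stepFactor
  cases s.fwd
  · simp only [Bool.false_eq_true, ↓reduceIte]; rfl
  · simp

/-- The step factor of an η-flat bond is within η of `1` (both orientations: `‖U* − 1‖ = ‖U − 1‖`). [cite: Balaban1985Averaging, (19) p.21] -/
theorem norm_stepFactor_sub_one_le (U₀ : GaugeField P j (Matrix.specialUnitaryGroup n ℂ)) (s : LStep P j) {η : ℝ}
    (h : ‖(U₀ s.bond : Matrix n n ℂ) - 1‖ ≤ η) :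
    ‖(((if s.fwd then U₀ s.bond else (U₀ s.bond)⁻¹ : Matrix.specialUnitaryGroup n ℂ)) : Matrix n n ℂ) - 1‖ ≤ η := by
  cases s.fwd
  · simp only [Bool.false_eq_true, ↓reduceIte]
    rw [← dist1_SU_eq, GaugeGroup.dist1_inv, dist1_SU_eq]; exact h
  · simpa using h

/-- **THE COVARIANT SIGNED SUM AT A NEAR-FLAT BACKGROUND IS THE FLAT SIGNED SUM**: if every bond of `Γ` has `‖U₀,b − 1‖ ≤ η` and `‖Y_b‖ ≤ δ`, then
`‖Y_{U₀}(Γ) − Y(Γ)‖ ≤ ηδ·|Γ|(|Γ|+1)` — each backward step term costs `2ηδ`, each transport of the tail costs `2η·|tail|δ`. [cite: Balaban1985Averaging, (58) p.27, (124) p.36] -/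
theorem norm_covWalkSum_sub_walkSum_le (U₀ : GaugeField P j (Matrix.specialUnitaryGroup n ℂ)) {Y : PBond P j → Matrix n n ℂ} {η δ : ℝ} (hη : 0 ≤ η) (hδ : 0 ≤ δ)
    (hY : ∀ b, ‖Y b‖ ≤ δ) :
    ∀ Γ : List (LStep P j), (∀ s ∈ Γ, ‖(U₀ s.bond : Matrix n n ℂ) - 1‖ ≤ η) →
      ‖covWalkSum U₀ Y Γ - walkSum Y Γ‖ ≤ η * δ * (Γ.length * (Γ.length + 1))
  | [], _ => by simp
  | s :: Γ, hΓ => by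
    have hs : ‖(U₀ s.bond : Matrix n n ℂ) - 1‖ ≤ η := hΓ s (by simp)
    have ih := norm_covWalkSum_sub_walkSum_le U₀ hη hδ hY Γ fun s' hs' => hΓ s' (List.mem_cons_of_mem _ hs')
    rw [covWalkSum_cons, walkSum_cons, List.length_cons]
    set g : Matrix.specialUnitaryGroup n ℂ := if s.fwd then U₀ s.bond else (U₀ s.bond)⁻¹ with hgdef
    have hsf : stepFactor U₀ s = (g : Matrix n n ℂ) := stepFactor_eq_coe U₀ s
    have hg : ‖(g : Matrix n n ℂ) - 1‖ ≤ η := norm_stepFactor_sub_one_le U₀ s hs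
    set S := covWalkSum U₀ Y Γ with hS
    have hSn : ‖S‖ ≤ Γ.length * δ := norm_covWalkSum_le U₀ hY Γ
    -- the step term
    have hstep : ‖covStep U₀ Y s - (if s.fwd then Y s.bond else -Y s.bond)‖ ≤ 2 * η * δ := by
      unfold covStep
      rw [hsf]
      cases s.fwd
      · simp only [Bool.false_eq_true, ↓reduceIte, ← neg_sub', norm_neg]
        calc ‖(g : Matrix n n ℂ) * Y s.bond * star (g : Matrix n n ℂ) - Y s.bond‖ ≤ 2 * ‖(g : Matrix n n ℂ) - 1‖ * ‖Y s.bond‖ := norm_conj_sub_self_le' g _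
          _ ≤ 2 * η * δ := by gcongr; exact hY _
      · simp only [↓reduceIte, sub_self, norm_zero]; positivity
    -- the transported tail
    have htail : ‖(g : Matrix n n ℂ) * S * star (g : Matrix n n ℂ) - S‖ ≤ 2 * η * (Γ.length * δ) :=
      (norm_conj_sub_self_le' g S).trans (by gcongr)
    have e : covStep U₀ Y s + (g : Matrix n n ℂ) * S * star (g : Matrix n n ℂ) - ((if s.fwd then Y s.bond else -Y s.bond) + walkSum Y Γ) =
        (covStep U₀ Y s - (if s.fwd then Y s.bond else -Y s.bond)) + ((g : Matrix n n ℂ) * S * star (g : Matrix n n ℂ) - S) + (S - walkSum Y Γ) := by abel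
    rw [hsf, e]
    calc _ ≤ ‖covStep U₀ Y s - (if s.fwd then Y s.bond else -Y s.bond)‖ + ‖(g : Matrix n n ℂ) * S * star (g : Matrix n n ℂ) - S‖ + ‖S - walkSum Y Γ‖ := norm_add₃_le
      _ ≤ 2 * η * δ + 2 * η * (Γ.length * δ) + η * δ * (Γ.length * (Γ.length + 1)) := by gcongr
      _ = η * δ * (((Γ.length + 1 : ℕ) : ℝ) * (((Γ.length + 1 : ℕ) : ℝ) + 1)) := by push_cast; ring

/-- **★ THE LINEARISED AVERAGE AT A NEAR-FLAT BACKGROUND IS THE FLAT ONE**: if `‖U₀,b − 1‖ ≤ η` for every bond issuing from `B(c₋) ∪ B(c₊)` and `‖Y_b‖ ≤ δ`, then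
`‖Q₁(U₀)Y(c) − (Q₁Y)(c)‖ ≤ 2ηδ·ℓ(ℓ+1)`, `ℓ = (d+2)L` (`(Q₁Y)(c) = BlockAveragingEMLLinearised.linAvg`, the flat linearised average, in its loop form `EMLSecondOrder.mean_walkSum_loop_add_axial_eq_linAvg`).
[cite: Balaban1985Averaging, Prop. 3 (124)–(125) p.36] -/
theorem norm_covLinAvg_sub_linAvg_le (hj : j + 1 ≤ P.m + P.K) (U₀ : GaugeField P j (Matrix.specialUnitaryGroup n ℂ)) {Y : PBond P j → Matrix n n ℂ} {η δ : ℝ}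
    (hη : 0 ≤ η) (hδ : 0 ≤ δ) (hY : ∀ b, ‖Y b‖ ≤ δ) (c : PBond P (j + 1))
    (hflat : ∀ b : PBond P j, (blockOf b.src = c.src ∨ blockOf b.src = c.tgt) → ‖(U₀ b : Matrix n n ℂ) - 1‖ ≤ η) :
    ‖covLinAvg U₀ Y c - linAvg Y c‖ ≤ 2 * (η * δ * ((((P.d + 2) * P.L : ℕ) : ℝ) * ((((P.d + 2) * P.L : ℕ) : ℝ) + 1))) := by
  set ℓ : ℝ := (((P.d + 2) * P.L : ℕ) : ℝ) with hℓ
  set B : ℝ := η * δ * (ℓ * (ℓ + 1)) with hB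
  have hc : (Fintype.card (Idx P) : ℂ) ≠ 0 := Nat.cast_ne_zero.mpr Fintype.card_pos.ne'
  rw [← mean_walkSum_loop_add_axial_eq_linAvg Y c, covLinAvg_def]
  -- loop part: termwise, each loop walk has length ≤ ℓ and lies over the two blocks
  have hmono : ∀ m : ℕ, m ≤ (P.d + 2) * P.L → η * δ * ((m : ℝ) * ((m : ℝ) + 1)) ≤ B := by
    intro m hm
    have hm' : (m : ℝ) ≤ ℓ := by rw [hℓ]; exact_mod_cast hm
    have : (m : ℝ) * ((m : ℝ) + 1) ≤ ℓ * (ℓ + 1) := by nlinarith [Nat.cast_nonneg (α := ℝ) m]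
    rw [hB]; exact mul_le_mul_of_nonneg_left this (mul_nonneg hη hδ)
  have hloop : ∀ i : Idx P, ‖covWalkSum U₀ Y (walk (emb c.src) (loopWord P.L c.dir (off i.1) i.2.1 i.2.2)) -
      walkSum Y (walk (emb c.src) (loopWord P.L c.dir (off i.1) i.2.1 i.2.2))‖ ≤ B := by
    intro i
    refine (norm_covWalkSum_sub_walkSum_le U₀ hη hδ hY _ fun s hs => hflat _ (blockOf_src_of_mem_walk hj c i s hs)).trans (hmono _ ?_)
    rw [length_walk]; exact length_loopWord_le c i
  -- the straight segment `[emb c₋, emb c₋ + L e_μ]` issues from the two blocks (cf. the tree's `NE7.blockOf_src_of_mem_axWalk`; inlined to keep the import list inside this problem)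
  have hline_mem : ∀ s ∈ walk (emb c.src) (List.replicate P.L (c.dir, true)), blockOf s.bond.src = c.src ∨ blockOf s.bond.src = c.tgt := by
    intro s hs
    obtain ⟨-, -, t, ht, hsrc⟩ := BlockAveragingHaarAC.mem_walk_replicate hs
    have hL := AveragingRT.two_mul_half_add_one P
    by_cases hnear : t ≤ (P.L - 1) / 2
    · left
      refine blockOf_eq_of_near_emb hj c.src s.bond.src (fun ν => if ν = c.dir then (t : ℤ) else 0) (fun ν => by rw [hsrc ν]) fun ν => ?_
      by_cases hν : ν = c.dir
      · rw [if_pos hν]; constructor <;> omega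
      · rw [if_neg hν]; constructor <;> omega
    · right
      refine blockOf_eq_of_near_emb hj c.tgt s.bond.src (fun ν => if ν = c.dir then ((t : ℤ) - P.L) else 0) (fun ν => ?_) fun ν => ?_
      · rw [hsrc ν, PBond.tgt, emb_shift_apply]
        by_cases hν : ν = c.dir
        · rw [if_pos hν, if_pos hν, if_pos hν]; push_cast; ring
        · rw [if_neg hν, if_neg hν, if_neg hν, add_zero]
      · by_cases hν : ν = c.dir
        · rw [if_pos hν]; constructor <;> omega
        · rw [if_neg hν]; constructor <;> omega
  have hline : ‖covWalkSum U₀ Y (walk (emb c.src) (List.replicate P.L (c.dir, true))) - walkSum Y (walk (emb c.src) (List.replicate P.L (c.dir, true)))‖ ≤ B := by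
    refine (norm_covWalkSum_sub_walkSum_le U₀ hη hδ hY _ fun s hs => hflat _ (hline_mem s hs)).trans (hmono _ ?_)
    exact length_walk_replicate_le _ _ _
  have e : ((Fintype.card (Idx P) : ℂ))⁻¹ • ∑ i : Idx P, covWalkSum U₀ Y (walk (emb c.src) (loopWord P.L c.dir (off i.1) i.2.1 i.2.2)) +
        covWalkSum U₀ Y (walk (emb c.src) (List.replicate P.L (c.dir, true))) -
      (((Fintype.card (Idx P) : ℂ))⁻¹ • ∑ i : Idx P, walkSum Y (walk (emb c.src) (loopWord P.L c.dir (off i.1) i.2.1 i.2.2)) +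
        walkSum Y (walk (emb c.src) (List.replicate P.L (c.dir, true)))) =
      ((Fintype.card (Idx P) : ℂ))⁻¹ • ∑ i : Idx P, (covWalkSum U₀ Y (walk (emb c.src) (loopWord P.L c.dir (off i.1) i.2.1 i.2.2)) -
          walkSum Y (walk (emb c.src) (loopWord P.L c.dir (off i.1) i.2.1 i.2.2))) +
        (covWalkSum U₀ Y (walk (emb c.src) (List.replicate P.L (c.dir, true))) - walkSum Y (walk (emb c.src) (List.replicate P.L (c.dir, true)))) := by
    rw [Finset.sum_sub_distrib, smul_sub]; abel
  rw [e]
  refine (norm_add_le _ _).trans ?_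
  have hmean : ‖((Fintype.card (Idx P) : ℂ))⁻¹ • ∑ i : Idx P, (covWalkSum U₀ Y (walk (emb c.src) (loopWord P.L c.dir (off i.1) i.2.1 i.2.2)) -
      walkSum Y (walk (emb c.src) (loopWord P.L c.dir (off i.1) i.2.1 i.2.2)))‖ ≤ B := by
    rw [norm_smul, norm_inv, Complex.norm_natCast]
    have hN : (0 : ℝ) < Fintype.card (Idx P) := by exact_mod_cast Fintype.card_pos
    rw [inv_mul_le_iff₀ hN]
    calc _ ≤ ∑ i : Idx P, ‖covWalkSum U₀ Y (walk (emb c.src) (loopWord P.L c.dir (off i.1) i.2.1 i.2.2)) -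
            walkSum Y (walk (emb c.src) (loopWord P.L c.dir (off i.1) i.2.1 i.2.2))‖ := norm_sum_le _ _
      _ ≤ ∑ _i : Idx P, B := Finset.sum_le_sum fun i _ => hloop i
      _ = Fintype.card (Idx P) * B := by rw [Finset.sum_const, Finset.card_univ, nsmul_eq_mul]
  linarith

/-! ## §3 The frame letter -/

/-- **★★ THE ONE-STEP FRAME LETTER**: for ANY gauge `u` in which the background is η-flat on the two blocks of `c` (`‖u(b₋)U₀,b u(b₊)* − 1‖ ≤ η` there) and any perturbation `‖Y_b‖ ≤ δ`,
`‖Q₁(U₀)Y(c) − u(y₀)*·(Q₁ Y^u)(c)·u(y₀)‖ ≤ 2ηδ·ℓ(ℓ+1)` with `Y^u_b = u(b₋)Y_b u(b₋)*`, `y₀ = emb c₋`: the covariant linearised (0.4) average at an ARBITRARY background is the flat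
linearised average of the frame-rotated perturbation, read back in the original frame at the block centre — no smallness of `U₀`'s bond variables, only of its curvature as seen by the
gauge. [cite: Balaban1985Averaging, (11)–(13) p.19, Prop. 3 (124)–(125) p.36] -/
theorem norm_covLinAvg_sub_conj_linAvg_le (hj : j + 1 ≤ P.m + P.K) (u : GaugeTransf P j (Matrix.specialUnitaryGroup n ℂ))
    (U₀ : GaugeField P j (Matrix.specialUnitaryGroup n ℂ)) {Y : PBond P j → Matrix n n ℂ} {η δ : ℝ} (hη : 0 ≤ η) (hδ : 0 ≤ δ) (hY : ∀ b, ‖Y b‖ ≤ δ)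
    (c : PBond P (j + 1))
    (hflat : ∀ b : PBond P j, (blockOf b.src = c.src ∨ blockOf b.src = c.tgt) → ‖((GaugeField.gaugeAct u U₀ b : Matrix.specialUnitaryGroup n ℂ) : Matrix n n ℂ) - 1‖ ≤ η) :
    ‖covLinAvg U₀ Y c - star (u (emb c.src) : Matrix n n ℂ) * linAvg (fun b => (u b.src : Matrix n n ℂ) * Y b * star (u b.src : Matrix n n ℂ)) c * (u (emb c.src) : Matrix n n ℂ)‖ ≤
      2 * (η * δ * ((((P.d + 2) * P.L : ℕ) : ℝ) * ((((P.d + 2) * P.L : ℕ) : ℝ) + 1))) := by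
  have hcov := covLinAvg_gaugeAct u U₀ Y c
  have hYu : ∀ b, ‖(u b.src : Matrix n n ℂ) * Y b * star (u b.src : Matrix n n ℂ)‖ ≤ δ := fun b => norm_conj_le_of_le _ (hY b)
  have hflat' := norm_covLinAvg_sub_linAvg_le hj (GaugeField.gaugeAct u U₀) hη hδ hYu c hflat
  rw [hcov] at hflat'
  set g := (u (emb c.src) : Matrix n n ℂ) with hg
  set A := covLinAvg U₀ Y c
  set F := linAvg (fun b => (u b.src : Matrix n n ℂ) * Y b * star (u b.src : Matrix n n ℂ)) c
  -- conjugate back by `g*`: `A − g* F g = g*·(g A g* − F)·g`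
  have e : A - star g * F * g = star g * (g * A * star g - F) * g := by
    rw [mul_sub, sub_mul]
    congr 1
    calc A = (star g * g) * A * (star g * g) := by rw [coe_star_mul_self, one_mul, mul_one]
      _ = star g * (g * A * star g) * g := by noncomm_ring
  rw [e]
  calc ‖star g * (g * A * star g - F) * g‖ = ‖g * A * star g - F‖ := by
        rw [CStarRing.norm_mul_mem_unitary _ (u (emb c.src)).2.1, CStarRing.norm_mem_unitary_mul _ (Unitary.star_mem (u (emb c.src)).2.1)]
    _ ≤ _ := hflat'

/-- **★★ [B7] PROP. 3 AT A GENERAL BACKGROUND WITH THE FLAT LINEAR TERM IN A FRAME** (one step; the κ-side input of the Newton shell): background `U₀` with (0.4) loop variables at `c` within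
`α ≤ 1/24` of `1`, perturbation `Y = UU₀⁻¹ − 1`, `‖Y_b‖ ≤ δ`, `48ℓδ ≤ 1`, `2ℓδ + α < δ_N`; ANY gauge `u` with `U₀^u` η-flat on the two blocks of `c`.  Then
`‖Ū(c)·Ū₀(c)* − 1 − u(y₀)*·(Q₁ Y^u)(c)·u(y₀)‖ ≤ 400ℓδ(ℓδ+α) + 2ηδℓ(ℓ+1)` — the tree's `norm_avgFun_ratio_sub_one_sub_covLinAvg_le` with its covariant linear term replaced by the FLAT
linearised average of the rotated perturbation (the operator the (LL) engine inverts), at the price `2ηδℓ(ℓ+1)`. [cite: Balaban1985Averaging, Prop. 3 (122)–(125) p.36] -/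
theorem norm_avgFun_ratio_sub_one_sub_conj_linAvg_le (hj : j + 1 ≤ P.m + P.K) (u : GaugeTransf P j (Matrix.specialUnitaryGroup n ℂ))
    (U₀ U : GaugeField P j (Matrix.specialUnitaryGroup n ℂ)) {δ α η : ℝ} (hδ : 0 ≤ δ) (hη : 0 ≤ η)
    (hY : ∀ b, ‖pertVar U₀ U b‖ ≤ δ) (h48 : 48 * ((((P.d + 2) * P.L : ℕ) : ℝ) * δ) ≤ 1) (c : PBond P (j + 1))
    (hα : ∀ i, GaugeGroup.dist1 (loopHol U₀ c i) ≤ α) (hα24 : α ≤ 1 / 24) (hN : 2 * ((((P.d + 2) * P.L : ℕ) : ℝ) * δ) + α < deltaSU n)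
    (hflat : ∀ b : PBond P j, (blockOf b.src = c.src ∨ blockOf b.src = c.tgt) → ‖((GaugeField.gaugeAct u U₀ b : Matrix.specialUnitaryGroup n ℂ) : Matrix n n ℂ) - 1‖ ≤ η) :
    ‖((avgFun (expMeanLogSU (n := n)) U c : Matrix.specialUnitaryGroup n ℂ) : Matrix n n ℂ) *
          star ((avgFun (expMeanLogSU (n := n)) U₀ c : Matrix.specialUnitaryGroup n ℂ) : Matrix n n ℂ) - 1 -
        star (u (emb c.src) : Matrix n n ℂ) * linAvg (fun b => (u b.src : Matrix n n ℂ) * pertVar U₀ U b * star (u b.src : Matrix n n ℂ)) c * (u (emb c.src) : Matrix n n ℂ)‖ ≤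
      400 * ((((P.d + 2) * P.L : ℕ) : ℝ) * δ) * ((((P.d + 2) * P.L : ℕ) : ℝ) * δ + α) +
        2 * (η * δ * ((((P.d + 2) * P.L : ℕ) : ℝ) * ((((P.d + 2) * P.L : ℕ) : ℝ) + 1))) := by
  have h1 := norm_avgFun_ratio_sub_one_sub_covLinAvg_le U₀ U hδ hY h48 c hα hα24 hN
  have h2 := norm_covLinAvg_sub_conj_linAvg_le hj u U₀ hη hδ hY c hflat
  have e : ((avgFun (expMeanLogSU (n := n)) U c : Matrix.specialUnitaryGroup n ℂ) : Matrix n n ℂ) *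
          star ((avgFun (expMeanLogSU (n := n)) U₀ c : Matrix.specialUnitaryGroup n ℂ) : Matrix n n ℂ) - 1 -
        star (u (emb c.src) : Matrix n n ℂ) * linAvg (fun b => (u b.src : Matrix n n ℂ) * pertVar U₀ U b * star (u b.src : Matrix n n ℂ)) c * (u (emb c.src) : Matrix n n ℂ) =
      (((avgFun (expMeanLogSU (n := n)) U c : Matrix.specialUnitaryGroup n ℂ) : Matrix n n ℂ) *
          star ((avgFun (expMeanLogSU (n := n)) U₀ c : Matrix.specialUnitaryGroup n ℂ) : Matrix n n ℂ) - 1 - covLinAvg U₀ (pertVar U₀ U) c) +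
      (covLinAvg U₀ (pertVar U₀ U) c -
        star (u (emb c.src) : Matrix n n ℂ) * linAvg (fun b => (u b.src : Matrix n n ℂ) * pertVar U₀ U b * star (u b.src : Matrix n n ℂ)) c * (u (emb c.src) : Matrix n n ℂ)) := by
    abel
  rw [e]
  exact (norm_add_le _ _).trans (add_le_add h1 h2)

end Summit.QuantumFields.YangMills.Theorems.CovLinAvgFrame

end
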